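/-
Copyright (c) 2026. All rights reserved.
Released under Apache 2.0 license as described in the file LICENSE.
-/
import Mathlib
import HarnessLib
import Literature.Topology.FourManifolds.BallComplementFraming
import Literature.Topology.FourManifolds.SpinProofs
import Literature.Topology.FourManifolds.SpinDiffeomorphProofs
import Literature.Topology.FourManifolds.HomotopySpheresStablyParallelizableProofs
import Literature.Topology.FourManifolds.EquidimensionalEmbedding
import Literature.Topology.FourManifolds.Homogeneity
import Literature.Topology.FourManifolds.NullImages
import Literature.Topology.FourManifolds.CloseMapsHomotopic
import Literature.Topology.FourManifolds.MapSmoothing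
import Literature.Topology.FourManifolds.ConnectedSum
import Literature.Topology.FourManifolds.CircleSurgeryExistence

/-!
# Sphere maps without stable tangent framing survive connected sums

Topic `Literature/Topology/FourManifolds`. Module E1 of the proof of
`Literature.Topology.FourManifolds.exists_middleLevel_isStabilization_of_isHCobordism` (Kirby 1989,
Ch. X p. 56, odd case: the levels `M₀ # k (S² × S²)` of the h-cobordism still contain the
2-spheres of `M₀` on which `w₂ ≠ 0`).  In the tree's elementary language a manifold is *odd* when
some map `S² → V` has no framing of `TV ⊕ ℝ` along it (`HasStableTangentFramingAlong`); we prove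
that oddness passes from `V` to any connected sum `V # Q`
(`exists_not_hasStableTangentFramingAlong_of_isConnectedSum`) and along diffeomorphisms:

* §1–§2 stable framings pull back along maps with invertible differential, in particular along
  smooth embeddings between manifolds of the same dimension (the proof of the tree's
  `IsStablyParallelizable.of_hasStableTangentFramingAlong_of_isInvertible_mfderiv`, carried along
  a map), and are homotopy invariant (`HasStableTangentFramingAlong.homotopy`);
* §3 a map `S² → V⁴` can be homotoped off a point: smooth approximation with closeness
  constraints (`exists_contMDiff_eqOn_mapsTo`, `exists_cover_homotopic_of_mapsTo`), a non-value
  near the point (the image is Lebesgue-null in a chart, read through the radial projection of the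
  punctured `ℝ³`, `addHaar_image_eq_zero_of_finrank_lt`), and homogeneity
  (`Diffeomorph.exists_isDiffeotopicToId_apply_eq_of_connectedSpace`);
* §4 the transport through the gluing map of the punctured summand.

Everything is proved; no definitions, no named facts.

## References

* R. C. Kirby, *The topology of 4-manifolds*, LNM 1374 (1989), Ch. X, p. 56. [Kirby1989]
* M. W. Hirsch, *Differential Topology*, GTM 33 (1976), Ch. 3 Thm. 2.5, Ch. 4 §1–§2. [HirschDT1976]
-/

noncomputable section

open Set Function Metric Topology Bundle Module MeasureTheory Filter
open scoped Topology Manifold ContDiff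

namespace Literature.Topology.FourManifolds

/-! ### 1. Pulling stable framings back along equidimensional immersions -/

section Pullback

variable {E : Type*} [NormedAddCommGroup E] [NormedSpace ℝ E] [FiniteDimensional ℝ E]
  {H : Type*} [TopologicalSpace H] {I : ModelWithCorners ℝ E H}
  {H' : Type*} [TopologicalSpace H'] {I' : ModelWithCorners ℝ E H'}
  {M : Type*} [TopologicalSpace M] [ChartedSpace H M] [IsManifold I 1 M]
  {N : Type*} [TopologicalSpace N] [ChartedSpace H' N] [IsManifold I' 1 N]
  {S : Type*} [TopologicalSpace S]

/-- **Stable framings pull back along maps with invertible differential**: if `φ : M → N` is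
`C¹` with `dφ` invertible at the points `g p`, a stable framing of `(φ ∘ g)*TN ⊕ ℝ` gives the
stable framing `p ↦ ((dφ_{g p})⁻¹ (sᵢ p).1, (sᵢ p).2)` of `g*TM ⊕ ℝ` (the proof of
`IsStablyParallelizable.of_hasStableTangentFramingAlong_of_isInvertible_mfderiv`, along `g`).
[cite: Hirsch1976, Ch. 4 §1 p. 88 and §2] -/
theorem HasStableTangentFramingAlong.of_comp_of_isInvertible_mfderiv {g : S → M} (hg : Continuous g)
    {φ : M → N} (hφ : ContMDiff I I' 1 φ) (hinv : ∀ p, (mfderiv I I' φ (g p)).IsInvertible)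
    (hs : HasStableTangentFramingAlong I' N (φ ∘ g)) : HasStableTangentFramingAlong I M g := by
  obtain ⟨s, hsc, hsc', hli⟩ := hs
  refine ⟨fun i p => ((mfderiv I I' φ (g p)).inverse (s i p).1, (s i p).2), fun i => ?_,
    fun i => hsc' i, fun p => ?_⟩
  · rw [continuous_iff_continuousAt]
    intro p₀
    rw [FiberBundle.continuousAt_totalSpace]
    refine ⟨hg.continuousAt, ?_⟩
    obtain ⟨x₀, hx₀⟩ : ∃ x₀, g p₀ = x₀ := ⟨_, rfl⟩
    have hgx : Tendsto g (𝓝 p₀) (𝓝 x₀) := hx₀ ▸ hg.continuousAt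
    rw [hx₀]
    set A : M → E →L[ℝ] E := inTangentCoordinates I I' id φ (mfderiv I I' φ) x₀ with hA
    have hAc : ContinuousAt A x₀ :=
      ((hφ x₀).mfderiv_const (m := 0) (by rw [zero_add])).continuousAt
    have hAgc : Tendsto (fun p => A (g p)) (𝓝 p₀) (𝓝 (A x₀)) := hAc.tendsto.comp hgx
    have hA0 : A x₀ = mfderiv I I' φ x₀ := by
      rw [hA, inTangentCoordinates_eq _ _ _ (mem_chart_source H x₀) (mem_chart_source H' (φ x₀))]
      ext v
      change tangentCoordChange I' (φ x₀) (φ x₀) (φ x₀)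
        (mfderiv I I' φ x₀ (tangentCoordChange I x₀ x₀ x₀ v)) = _
      rw [tangentCoordChange_self (by simp), tangentCoordChange_self (by simp)]
      rfl
    have hinv₀ : (mfderiv I I' φ x₀).IsInvertible := hx₀ ▸ hinv p₀
    have hAinv : ∀ᶠ p in 𝓝 p₀, (A (g p)).IsInvertible :=
      hAgc (isOpen_setOf_isInvertible.mem_nhds (by rw [mem_setOf_eq, hA0]; exact hinv₀))
    have hσ : ContinuousAt (fun p => (trivializationAt E (TangentSpace I') (φ x₀)
        (⟨φ (g p), (s i p).1⟩ : TangentBundle I' N)).2) p₀ := by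
      have := (hsc i).continuousAt (x := p₀)
      rw [FiberBundle.continuousAt_totalSpace] at this
      have h2 := this.2
      change ContinuousAt (fun p => (trivializationAt E (TangentSpace I') (φ (g p₀))
        (⟨φ (g p), (s i p).1⟩ : TangentBundle I' N)).2) p₀ at h2
      rw [hx₀] at h2
      exact h2
    have h1 : ∀ᶠ p in 𝓝 p₀, g p ∈ (chartAt H x₀).source :=
      hgx.eventually ((chartAt H x₀).open_source.mem_nhds (mem_chart_source H x₀))
    have h2 : ∀ᶠ p in 𝓝 p₀, φ (g p) ∈ (chartAt H' (φ x₀)).source :=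
      (hφ.continuous.continuousAt.tendsto.comp hgx).eventually
        ((chartAt H' (φ x₀)).open_source.mem_nhds (mem_chart_source H' (φ x₀)))
    have hid : ∀ᶠ p in 𝓝 p₀, A (g p) ((trivializationAt E (TangentSpace I) x₀
        (⟨g p, (mfderiv I I' φ (g p)).inverse (s i p).1⟩ : TangentBundle I M)).2) =
          (trivializationAt E (TangentSpace I') (φ x₀) (⟨φ (g p), (s i p).1⟩ : TangentBundle I' N)).2 := by
      filter_upwards [h1, h2] with p hx1 hx2
      rw [hA, inTangentCoordinates_eq _ _ _ (show id (g p) ∈ (chartAt H (id x₀)).source from hx1) hx2,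
        trivializationAt_snd_eq_tangentCoordChange, trivializationAt_snd_eq_tangentCoordChange]
      change tangentCoordChange I' (φ (g p)) (φ x₀) (φ (g p)) (mfderiv I I' φ (g p)
        (tangentCoordChange I x₀ (g p) (g p) (tangentCoordChange I (g p) x₀ (g p)
          ((mfderiv I I' φ (g p)).inverse (s i p).1)))) = tangentCoordChange I' (φ (g p)) (φ x₀) (φ (g p)) (s i p).1
      have hx' : g p ∈ (extChartAt I (g p)).source ∩ (extChartAt I x₀).source ∩ (extChartAt I (g p)).source := by
        simp only [extChartAt_source, mem_inter_iff, mem_chart_source, hx1, and_self]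
      rw [tangentCoordChange_comp hx', tangentCoordChange_self (by simp),
        (hinv p).self_apply_inverse]
    obtain ⟨e, he⟩ := (show (A x₀).IsInvertible by rw [hA0]; exact hinv₀)
    have hinvc : ContinuousAt (fun p => (A (g p)).inverse ((trivializationAt E (TangentSpace I')
        (φ x₀) (⟨φ (g p), (s i p).1⟩ : TangentBundle I' N)).2)) p₀ := by
      have h1 : ContinuousAt ContinuousLinearMap.inverse (A x₀) := by
        rw [← he]
        exact (contDiffAt_map_inverse (n := 0) e).continuousAt
      have h3 : ContinuousAt (fun p => (A (g p)).inverse) p₀ := by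
        have h4 : Tendsto (fun p => (A (g p)).inverse) (𝓝 p₀) (𝓝 (A x₀).inverse) := h1.tendsto.comp hAgc
        have h5 : (A x₀) = A (g p₀) := by rw [hx₀]
        rw [ContinuousAt, ← h5]; exact h4
      exact h3.clm_apply hσ
    refine hinvc.congr ?_
    filter_upwards [hid, hAinv] with p hp hpinv
    rw [← hp, hpinv.inverse_apply_self]
  · beta_reduce
    refine LinearIndependent.of_comp
      ((show E →L[ℝ] E from mfderiv I I' φ (g p)).toLinearMap.prodMap LinearMap.id) ?_
    convert hli p using 1
    funext i
    exact Prod.ext ((hinv p).self_apply_inverse (s i p).1) rfl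

end Pullback

/-! ### 2. Consequences: open submanifolds, equidimensional embeddings, diffeomorphisms, homotopies -/

section Transfer

/-- Local notation: `𝔼 n` is the model Euclidean space `EuclideanSpace ℝ (Fin n)`. -/
local notation "𝔼 " n:arg => EuclideanSpace ℝ (Fin n)

variable {n : ℕ} {M : Type*} [TopologicalSpace M] [ChartedSpace (𝔼 n) M] [IsManifold (𝓡 n) ∞ M]
  {N : Type*} [TopologicalSpace N] [ChartedSpace (𝔼 n) N] [IsManifold (𝓡 n) ∞ N]
  {S : Type*} [TopologicalSpace S]

/-- **Stable framings pull back along smooth embeddings between manifolds of the same dimension.**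
[cite: Hirsch1976, Ch. 4 §1–§2] -/
theorem HasStableTangentFramingAlong.of_comp_isSmoothEmbedding {g : S → M} (hg : Continuous g)
    {j : M → N} (hj : Manifold.IsSmoothEmbedding (𝓡 n) (𝓡 n) ∞ j)
    (hs : HasStableTangentFramingAlong (𝓡 n) N (j ∘ g)) : HasStableTangentFramingAlong (𝓡 n) M g := by
  have hloc : IsLocalDiffeomorph (𝓡 n) (𝓡 n) ∞ j := hj.isLocalDiffeomorph_of_finrank_eq rfl
  refine HasStableTangentFramingAlong.of_comp_of_isInvertible_mfderiv hg (hj.contMDiff.of_le (by exact_mod_cast le_top)) (fun p => ?_) hs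
  exact ⟨(hloc (g p)).mfderivToContinuousLinearEquiv (by simp), rfl⟩

/-- **Stable framings along homotopic maps.** [folklore] -/
theorem HasStableTangentFramingAlong.of_homotopic {K : Type*} [TopologicalSpace K] [CompactSpace K] [T2Space K]
    [TopologicalSpace.MetrizableSpace K] {f₀ f₁ : C(K, M)} (h : f₀.Homotopic f₁)
    (h₀ : HasStableTangentFramingAlong (𝓡 n) M f₀) : HasStableTangentFramingAlong (𝓡 n) M f₁ := by
  obtain ⟨F⟩ := h
  have h0 : HasStableTangentFramingAlong (𝓡 n) M (fun y => (F : C(unitInterval × K, M)) (0, y)) := by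
    have : (fun y => (F : C(unitInterval × K, M)) (0, y)) = f₀ := funext fun y => F.apply_zero y
    rw [this]; exact h₀
  have h1 := HasStableTangentFramingAlong.homotopy (m := n) (F : C(unitInterval × K, M)) h0
  have : (fun y => (F : C(unitInterval × K, M)) (1, y)) = f₁ := funext fun y => F.apply_one y
  rw [this] at h1
  exact h1

/-- **Maps without stable tangent framing push forward along diffeomorphisms.** [folklore] -/
theorem exists_not_hasStableTangentFramingAlong_of_diffeomorph {K : Type*} [TopologicalSpace K]
    (φ : M ≃ₘ⟮𝓡 n, 𝓡 n⟯ N) (h : ∃ g : C(K, M), ¬ HasStableTangentFramingAlong (𝓡 n) M g) :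
    ∃ g : C(K, N), ¬ HasStableTangentFramingAlong (𝓡 n) N g := by
  obtain ⟨g, hg⟩ := h
  refine ⟨⟨φ ∘ g, φ.continuous.comp g.continuous⟩, fun hφg => hg ?_⟩
  have h := hφg.diffeomorph_comp φ.symm (by simp)
  have : (φ.symm : N → M) ∘ ((⟨φ ∘ g, φ.continuous.comp g.continuous⟩ : C(K, N)) : K → N) = g := by
    funext x; exact φ.symm_apply_apply (g x)
  rw [this] at h
  exact h

end Transfer

/-! ### 3. Sphere maps can be pushed off a point -/

section Avoid

/-- Local notation: `𝔼 n` is the model Euclidean space `EuclideanSpace ℝ (Fin n)`. -/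
local notation "𝔼 " n:arg => EuclideanSpace ℝ (Fin n)

/-- Local notation: the unit `2`-sphere. -/
local notation "𝕊²" => (sphere (0 : EuclideanSpace ℝ (Fin (2 + 1))) 1)

variable {V : Type*} [TopologicalSpace V] [T2Space V] [CompactSpace V] [ChartedSpace (𝔼 4) V] [IsManifold (𝓡 4) ∞ V]

/-- **A continuous map of the 2-sphere into a compact 4-manifold is homotopic to a smooth one**
(relative smoothing with closeness constraints, and nearby maps are homotopic).
[cite: HirschDT1976, Ch. 2 §2 Thm. 2.6] -/
theorem exists_contMDiff_homotopic_sphere (h : C(𝕊², V)) :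
    ∃ g : C(𝕊², V), ContMDiff (𝓡 2) (𝓡 4) ∞ g ∧ h.Homotopic g := by
  haveI := Fact.mk (@finrank_euclideanSpace_fin ℝ _ (2 + 1))
  obtain ⟨Uc, hUco, hUcmem, hUchom⟩ := exists_cover_homotopic_of_mapsTo (n := 4) V
  have hnb : ∀ p : 𝕊², ∃ Kp : Set 𝕊², IsCompact Kp ∧ Kp ∈ 𝓝 p ∧ MapsTo h Kp (Uc (h p)) := by
    intro p
    have hO : IsOpen (h ⁻¹' Uc (h p)) := (hUco _).preimage h.continuous
    obtain ⟨L, hLc, hpL, hLW⟩ := exists_compact_between isCompact_singleton hO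
      (singleton_subset_iff.2 (hUcmem (h p)))
    exact ⟨L, hLc, mem_interior_iff_mem_nhds.1 (hpL (mem_singleton p)), fun q hq => hLW hq⟩
  choose Kp hKpc hKpn hKpU using hnb
  obtain ⟨t, -, htK⟩ := (isCompact_univ (X := 𝕊²)).elim_nhds_subcover Kp fun p _ => hKpn p
  obtain ⟨g, hgs, -, hgU⟩ := exists_contMDiff_eqOn_mapsTo (EM := 𝔼 2) (HM := 𝔼 2) (IM := 𝓡 2) (M := 𝕊²) (n := 4) (V := V) (f := h) h.continuous isClosed_empty isOpen_empty
    (empty_subset _) (fun x hx => hx.elim) (C := fun p : (t : Set 𝕊²) => Kp p) (U := fun p => Uc (h p))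
    (fun p => hKpc p) (fun p => hUco _) fun p => hKpU p
  have hclose : ∀ p, ∃ y, h p ∈ Uc y ∧ g p ∈ Uc y := by
    intro p
    obtain ⟨p₀, hp₀t, hp₀⟩ := mem_iUnion₂.1 (htK (mem_univ p))
    exact ⟨h p₀, hKpU p₀ hp₀, hgU ⟨p₀, hp₀t⟩ hp₀⟩
  obtain ⟨Hm, -⟩ := hUchom h ⟨g, hgs.continuous⟩ hclose
  exact ⟨⟨g, hgs.continuous⟩, hgs, ⟨Hm⟩⟩

omit [T2Space V] [CompactSpace V] in
/-- **A smooth map of the 2-sphere into a 4-manifold misses points near any point**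
(its image is Lebesgue-null in charts: read the map on the punctured `ℝ³` through the radial
projection, `addHaar_image_eq_zero_of_finrank_lt`). [cite: MilnorTDV1965, §3] -/
theorem exists_notMem_range_of_contMDiff_sphere {g : 𝕊² → V} (hg : ContMDiff (𝓡 2) (𝓡 4) ∞ g) (p₀ : V) :
    ∃ q ∈ (chartAt (𝔼 4) p₀).source, q ∉ range g := by
  haveI := Fact.mk (@finrank_euclideanSpace_fin ℝ _ (2 + 1))
  set φ := extChartAt (𝓡 4) p₀ with hφ
  set pt : 𝕊² := spherePt 2 with hpt
  -- the radial reading of the chart coordinate of `g`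
  set O : Set (𝔼 3) := {y | y ≠ 0} ∩ (fun y => g (radialProjection pt y)) ⁻¹' (chartAt (𝔼 4) p₀).source with hO
  set F : 𝔼 3 → 𝔼 4 := fun y => φ (g (radialProjection pt y)) with hF
  have hgr : ContMDiffOn 𝓘(ℝ, 𝔼 3) (𝓡 4) 1 (fun y => g (radialProjection pt y)) {y | y ≠ 0} :=
    (hg.of_le (by exact_mod_cast le_top)).comp_contMDiffOn ((contMDiffOn_radialProjection pt).of_le (by exact_mod_cast le_top))
  have hOo : IsOpen O := by
    refine hgr.continuousOn.isOpen_inter_preimage isOpen_ne (chartAt (𝔼 4) p₀).open_source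
  have hFd : DifferentiableOn ℝ F O := by
    have h1 : ContMDiffOn 𝓘(ℝ, 𝔼 3) 𝓘(ℝ, 𝔼 4) 1 F O := by
      have hc : ContMDiffOn (𝓡 4) 𝓘(ℝ, 𝔼 4) 1 φ (chartAt (𝔼 4) p₀).source := by
        rw [hφ]; exact contMDiffOn_extChartAt (I := 𝓡 4) (x := p₀) (n := 1)
      exact hc.comp (hgr.mono inter_subset_left) fun y hy => hy.2
    exact ((contMDiffOn_iff_contDiffOn (E := 𝔼 3) (E' := 𝔼 4) (f := F) (s := O) (n := 1)).mp h1).differentiableOn one_ne_zero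
  have hnull : (volume : Measure (𝔼 4)) (F '' O) = 0 :=
    addHaar_image_eq_zero_of_finrank_lt volume (by simp) hFd
  -- the chart image of `range g ∩ source` is inside `F '' O`
  have hsub : φ '' (range g ∩ (chartAt (𝔼 4) p₀).source) ⊆ F '' O := by
    rintro _ ⟨_, ⟨⟨x, rfl⟩, hx⟩, rfl⟩
    refine ⟨(x : 𝔼 3), ⟨ne_zero_of_mem_unit_sphere x, ?_⟩, ?_⟩
    · rw [mem_preimage, radialProjection_coe_sphere]; exact hx
    · change φ (g (radialProjection pt (x : 𝔼 3))) = φ (g x); rw [radialProjection_coe_sphere]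
  obtain ⟨q', hq', hq'S⟩ := exists_mem_notMem_of_measure_zero (volume : Measure (𝔼 4)) (isOpen_extChartAt_target p₀)
    ⟨φ p₀, mem_extChartAt_target p₀⟩ (measure_mono_null hsub hnull)
  refine ⟨φ.symm q', ?_, ?_⟩
  · rw [← extChartAt_source (𝓡 4) p₀]; exact φ.map_target hq'
  · rintro ⟨x, hx⟩
    apply hq'S
    refine ⟨g x, ⟨⟨x, rfl⟩, ?_⟩, ?_⟩
    · rw [hx, ← extChartAt_source (𝓡 4) p₀]; exact φ.map_target hq'
    · rw [hx]; exact φ.right_inv hq'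

/-- **A continuous map of the 2-sphere into a connected compact 4-manifold can be homotoped off
any point** (smooth approximation, null image, and homogeneity: a diffeomorphism diffeotopic to the
identity moving a non-value to the given point). [cite: HirschDT1976, Ch. 3 Thm. 2.5] -/
theorem exists_homotopic_forall_ne [ConnectedSpace V] (h : C(𝕊², V)) (p₀ : V) :
    ∃ h' : C(𝕊², V), h.Homotopic h' ∧ ∀ x, h' x ≠ p₀ := by
  obtain ⟨g, hgs, hhg⟩ := exists_contMDiff_homotopic_sphere h
  obtain ⟨q, -, hq⟩ := exists_notMem_range_of_contMDiff_sphere hgs p₀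
  obtain ⟨P, ⟨D, hD⟩, hPq⟩ := Diffeomorph.exists_isDiffeotopicToId_apply_eq_of_connectedSpace (E := 𝔼 4) q p₀
  refine ⟨⟨P ∘ g, P.continuous.comp g.continuous⟩, hhg.trans ?_, fun x hx => hq ⟨x, P.injective (hx.trans hPq.symm)⟩⟩
  -- the diffeotopy gives a homotopy from `g` to `P ∘ g`
  refine ⟨{ toFun := fun sx => (D.track ((sx.1 : ℝ), g sx.2)).2
            continuous_toFun := ?_
            map_zero_left := fun x => ?_
            map_one_left := fun x => ?_ }⟩
  · exact continuous_snd.comp (D.track.continuous.comp ((continuous_subtype_val.comp continuous_fst).prodMk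
      (g.continuous.comp continuous_snd)))
  · exact D.track_zero (g x)
  · change (D.track (1, g x)).2 = P (g x)
    rw [← hD]; rfl

end Avoid

/-! ### 4. Odd spheres survive connected sums -/

section Sum

/-- Local notation: `𝔼 n` is the model Euclidean space `EuclideanSpace ℝ (Fin n)`. -/
local notation "𝔼 " n:arg => EuclideanSpace ℝ (Fin n)

/-- Local notation: the unit `2`-sphere. -/
local notation "𝕊²" => (sphere (0 : EuclideanSpace ℝ (Fin (2 + 1))) 1)

variable {V : Type*} [TopologicalSpace V] [T2Space V] [CompactSpace V] [ConnectedSpace V] [ChartedSpace (𝔼 4) V]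
  [IsManifold (𝓡 4) ∞ V]
  {EN HN : Type*} [NormedAddCommGroup EN] [NormedSpace ℝ EN] [TopologicalSpace HN] {IN : ModelWithCorners ℝ EN HN}
  {Q : Type*} [TopologicalSpace Q] [T2Space Q] [ChartedSpace HN Q]
  {V₂ : Type*} [TopologicalSpace V₂] [ChartedSpace (𝔼 4) V₂] [IsManifold (𝓡 4) ∞ V₂]

/-- **A sphere map without stable tangent framing survives a connected sum**: if `V₂` is a
connected sum `V # Q` and `V` contains a map `S² → V` along which `TV ⊕ ℝ` has no framing, then so
does `V₂` — push the map off the centre of the summing disc (`exists_homotopic_forall_ne`; the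
framing obstruction is homotopy invariant), include the punctured `V` into `V₂` by the gluing map,
and pull framings back along this equidimensional embedding and the open inclusion.
[cite: Kirby1989, Ch. X p. 56] -/
theorem exists_not_hasStableTangentFramingAlong_of_isConnectedSum
    (hsum : IsConnectedSum (𝓡 4) (𝓡 4) IN V Q V₂)
    (hodd : ∃ h : C(𝕊², V), ¬ HasStableTangentFramingAlong (𝓡 4) V h) :
    ∃ h₂ : C(𝕊², V₂), ¬ HasStableTangentFramingAlong (𝓡 4) V₂ h₂ := by
  haveI := Fact.mk (@finrank_euclideanSpace_fin ℝ _ (2 + 1))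
  obtain ⟨h, hh⟩ := hodd
  obtain ⟨i₁, i₂, hi₁, hi₂, jA, jB, hjA, -, -, -, -, -⟩ := hsum
  obtain ⟨h', hhh', hne⟩ := exists_homotopic_forall_ne h (i₁ 0)
  have hh' : ¬ HasStableTangentFramingAlong (𝓡 4) V h' := fun hf => hh (hf.of_homotopic hhh'.symm)
  -- lift to the punctured manifold and include
  set hA : C(𝕊², puncture i₁) := ⟨fun x => ⟨h' x, hne x⟩, h'.continuous.subtype_mk _⟩ with hhA
  refine ⟨⟨jA ∘ hA, hjA.isEmbedding.continuous.comp hA.continuous⟩, fun hf => hh' ?_⟩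
  have h1 : HasStableTangentFramingAlong (𝓡 4) (puncture i₁) hA :=
    HasStableTangentFramingAlong.of_comp_isSmoothEmbedding hA.continuous hjA hf
  -- along the open inclusion: the trivialisations of `T(puncture)` are those of `TV`
  obtain ⟨s, hs, hs', hli⟩ := h1
  refine ⟨s, fun i => ?_, hs', hli⟩
  rw [continuous_iff_continuousAt]
  intro p
  have := (hs i).continuousAt (x := p)
  rw [FiberBundle.continuousAt_totalSpace] at this ⊢
  refine ⟨h'.continuous.continuousAt, ?_⟩
  have key : (fun q => ((trivializationAt (𝔼 4) (TangentSpace (𝓡 4)) (hA p))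
        (TotalSpace.mk' (𝔼 4) (hA q) (s i q).1 : TangentBundle (𝓡 4) (puncture i₁))).2) =
      fun q => ((trivializationAt (𝔼 4) (TangentSpace (𝓡 4)) ((hA p : puncture i₁) : V))
        (TotalSpace.mk' (𝔼 4) ((hA q : puncture i₁) : V) (s i q).1 : TangentBundle (𝓡 4) V)).2 := by
    funext q
    change tangentCoordChange (𝓡 4) (hA q) (hA p) (hA q) (s i q).1 =
      tangentCoordChange (𝓡 4) ((hA q : puncture i₁) : V) ((hA p : puncture i₁) : V) ((hA q : puncture i₁) : V) (s i q).1
    rw [tangentCoordChange_opens]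
  rw [key] at this
  exact this.2

end Sum

end Literature.Topology.FourManifolds
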